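import Summits.QuantumFields.YangMills.Theorems.AtomicCalibrationRMirrorCalibrationKDefs
import Summits.QuantumFields.YangMills.Theorems.AtomicCalibrationRSmearedIVDataK
import Summits.QuantumFields.YangMills.Theorems.AtomicCalibrationRAtomCeilings
import HarnessLib

/-!
# LINE «OctaveDoubling» REV 2.1 on the leaf `InfiniteVolumeContinuum.HypercubicOSDataFromInfiniteVolume` (stmt-QuantumFields-19868)

Planner seat `ym-idea-11` g19 (D-0145 ideator, lens «wuc» = weakest unknown consequence), 2026-08-29; second line of g19.
bears_on: LADDER-YM R2a-IV (leaf 19868).  Sister line: «TemperedPeak» REV 2 (`Lines/tempered_peak.lean`), whose load-bearing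
stub E_T `PinnedTemperedCeiling` (the TEMPERED on-axis mirror ceiling `|c_{q,k}(t)| ≤ (C/R⁴)²(ℓ₄/(Rs))^M`, `∃ M`, at a
PINNED onset scale `s`) is here DECOMPOSED DYADICALLY and the decomposition is PROVED:

  `pinnedTempered_of_octaves : PinnedTopOctaveCeiling → PinnedOctaveStep → PinnedTemperedCeiling`   (sorry-free).

## REV 2 — answers idea-crit-9 VERDICT #95 (STRIKE AS TYPED of «TemperedPeak» REV 1; the same defect sat in REV 1 of this line)
REV 1's prefix was 26791's, whose test scale `s` FLOATS (the sub-onset guard is upward closed, the conclusion does not mention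
`s`): testing at `s' := min 1 (ℓ₄/R)` made `TopOctaveCeiling ⇔ 26791` (choose `κ < 1/(2ℓ₄)`) and the line collapsed to
{N, 26791, 28168}.  REV 2 PINS the test scale in D1, D2 and E_T alike (extra hypothesis: `s` itself carries the `∀L`-floors
of level `ε`), and carries the sister's REV 2 currencies (`TemperedAtomCeilingsK`, `TemperedMomentBoundA`: level at the
atom's own scale, ceiling form) — see `Lines/tempered_peak.lean` REV 2 header.  The octave induction is unchanged (the pin
passes through: it concerns the fixed `(β, s)` at which the induction runs).

## The two new stubs (wuc one level down: each is a consequence of 26791, kernel-checked)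
* D1 `PinnedTopOctaveCeiling` — E_T's conclusion owed ONLY at the NON-DOUBLABLE scales `R`: the top octave(s) below the floors'
  PINNED onset scale (`κ ℓ₄ < R s ≤ ℓ₄`, for every fixed `κ ∈ (0,1]`, constants depending on `κ`) or the top octave of the odd torus
  (`4R+8 ≤ L < 8R+8`, finite-size version).  `E_T ⇒ D1` (`pinnedTopOctave_of_tempered`).  This is the hyperscaling WALL met
  one octave wide instead of across all sub-unit scales.
* D2 `PinnedOctaveStep` — ULTRAVIOLET-WARD OCTAVE REGULARITY of the dimensionless on-axis mirror covariance: strictly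
  below the unit (`2Rs ≤ ℓ₄`) and inside the torus (`8R+8 ≤ L`), a bound `B` on `|c(t')|` over the doubled octave
  `t' ∈ [4R+2, L]` propagates one octave down, `|c(t)| ≤ K·max(B, (C₀/R⁴)²)` on `t ∈ [2R+2, L]`, with ANY β-uniform
  `K ≥ 1` — «`R⁸c(R)` never jumps by more than a factor `K` per octave toward the UV, unless it is below the hyperscaling
  size `C₀²`».  `26791 ⇒ D2` with `K = 1` (`pinnedOctaveStep_of_axisMirror`).  In the transfer-matrix picture
  (`c(t) = ∫ λ^t dν_A`, completely monotone) D2 is NOT a consequence of complete monotonicity (Cauchy–Schwarz only gives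
  `c(2R+1)² ≤ c(0)·c(4R+2)`): it is a dynamical statement — a one-sided Harnack ∕ doubling inequality for the RG flow of
  the two-point amplitude, true in perturbation theory (`R⁸c(R) ∝ g(R)⁴`, `g` moves by a bounded factor per octave) and
  in every massive or massless generalised free field (`K = 2⁸`, `C₀` = the amplitude).
* The induction (`octave_induction`, pure real analysis, proved): with `ℓ := min ℓ₄¹ ℓ₄²`, `κ := ℓ/(2ℓ₄¹)`, `M` with
  `M₁ ≤ M`, `K ≤ 2^M`, `A := max(C₁²(ℓ₄¹/ℓ)^{M₁}, K C₀²)`: strong induction on `L − R` doubles `R` while `2Rs ≤ ℓ` and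
  `8R+8 ≤ L` (D2, ratio `K·2^{-8-M} ≤ 1`), and anchors at the first non-doublable scale (D1); result
  `|c(t)| ≤ (√A/R⁴)²(ℓ/(Rs))^M` = E_T with `M = max(M₁, ⌈log₂K⌉)`.
So the E-wall of the sister line is split into «hyperscaling on ONE octave» (D1, the wall, narrowed) and «no abrupt
UV-ward growth» (D2, a regularity statement measurable octave by octave); per-octave multiplicative losses, fatal for 26791,
cost nothing.

## Stubs (7) and composition
* D1  `stub_pinnedTopOctaveCeiling : PinnedTopOctaveCeiling` — NEW (REV 2: pinned).  [E-wall n = 2, ONE octave at the unit (+ finite-size twin); hard]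
* D2  `stub_pinnedOctaveStep : PinnedOctaveStep` — NEW (REV 2: pinned).  [UV-ward octave regularity; multiscale ∕ RG class; L–XL]
* N   `stub_onsetFloorsK : OnsetFloorsK` — BY NAME (K1 currency).  [N-wall residual]
* CAL `stub_temperedCalibrationK : OnsetFloorsK → PinnedTemperedCeiling → TemperedAtomCeilingsK`  [B6K ∘ 26792-port ∘ E1 twin, L]
* W   `stub_weightedWhitneyPkg : WhitneyPkgW`  [pure analysis, L]
* E3T `stub_temperedMomentBoundA : WhitneyPkgW → AtomicSqrtDominationR → TemperedMomentBoundA`  [E3 twin, L/XL]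
* K2R `stub_atomicSqrtDominationR : AtomicSqrtDominationR` — item 28168 BY NAME.
  (The four currencies `PinnedTemperedCeiling`, `TemperedAtomCeilingsK`, `TemperedMomentBoundA`, `WhitneyPkgW` and the glue
  are character for character those of `Lines/tempered_peak.lean` REV 2 §1–§2 — definitionally equal; workfiles are not
  importable on the farm, hence the copies.)
* composition `HypercubicOSDataFromInfiniteVolume_of_octaveDoubling` (sorry-free) concludes the leaf BY NAME:
  `smearedIVDataK_proof (smearedIVInputK_of_temperedA (CAL N (pinnedTempered_of_octaves D1 D2)) (E3T W K2R))`.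

WHY NOVEL vs the listed lines (CofinalWindows REV 7, CofinalFRS REV 6, MirrorCalibration REV 4∕5, AtomicEngine, TemperedPeak):
the first four consume the on-axis ceiling at full strength on ALL sub-unit octaves (26791∕26671); TemperedPeak consumes the
tempered envelope E_T as one stub.  Here the E-input is two statements of different KIND: a one-octave hyperscaling bound and
an octave-to-octave regularity inequality — the second is the natural output of any inductive multiscale expansion with
`O(1)` non-summable per-step constants (Bałaban's small-field RG; Magnen–Rivasseau–Sénéor), the first is where strong coupling
is genuinely met, and ONLY there.  Lever in five words: «doubling inequality replaces the envelope».
CHEAPEST FALSIFIER ∕ instrument row: D2 is calibrated DIRECTLY by the octave ratios `ϱ(R) := R⁸c(R)/max((2R)⁸c(2R), C₀²)`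
read off the N18 smeared-slice two-point readout across the sub-unit octaves at two or three β (`K := max ϱ`; β-growth of
`max ϱ` kills D2); D1 by `R⁸c(R)` on the unit octave alone (β-growth kills D1).  Model checks (free): massless and massive
lattice generalised free fields obey D2 with `K = 2⁸`; a reflection-positive two-mode covariance `A₁e^{-m₁t} + A₂e^{-m₂t}`
violates the PURE ratio form (`e^{2m₂R}`) but obeys D2 thanks to the `max(·, C₀²/R⁸)` escape whenever the heavy mode is
lattice-scale (`A₂(4/m₂)⁸e^{-8} ≤ K C₀²`) — D2 fails exactly on an intermediate-scale mode `s ≪ m ≪ 1` with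
super-hyperscaling amplitude `A_m ≫ m⁸`, i.e. on a hyperscaling violation INSIDE the sub-unit window, which is what the
instrument looks for.
HONEST LABEL: a SKELETON; it proves no stub, no crux, no rung, no leaf and no summit (the proved theorems are the dyadic
reduction and the wuc certificates only); nothing about Bałaban's RG or Clay is asserted; the Yang–Mills mass gap is NOT proved.
-/

set_option autoImplicit false

noncomputable section

open scoped BigOperators
open MeasureTheory Filter Topology
open Literature.MathematicalPhysics.QuantumFieldTheory Literature.MathematicalPhysics.QuantumLattice
open Literature.MathematicalPhysics.AQFT (IsOffDiagonal)
open Summit.QuantumFields.YangMills.Theorems.InfiniteVolume (stateMomentStr)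
open Summit.QuantumFields.YangMills.Cruxes.OSLegsFromFemtoAndGap.DlrCollarTransfer (Q2 Q3 torusE plane)
open Summit.QuantumFields.YangMills.Cruxes.AtomicCalibrationR.MirrorCalibration
  (SmearedMomentBound onsetSet IsAdmissibleProfile LowerBoundsK OnsetFloorsK MirrorCalibratedUnitK SmearedIVInputK
    WhitneyPkg smearedIVDataK_proof atomWt reflSite AtomCeilings atomCeilings_holds)
open Summit.QuantumFields.YangMills.Theses.OnsetTautology (AtomicSqrtDominationR)
open Summit.QuantumFields.YangMills.Theses.SquareRootCeilings (AxisMirrorCeiling)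

namespace Summit.QuantumFields.YangMills.Cruxes.HypercubicOSDataFromInfiniteVolume.OctaveDoubling

/-! ## §1 The currencies (character for character `Lines/tempered_peak.lean` REV 2 §1) and the two pinned octave stubs D1, D2 -/

/-- **E_T `PinnedTemperedCeiling`** (REV 2 of `TemperedAxisMirrorCeiling`) — item 26791 `SquareRootCeilings.AxisMirrorCeiling`
VERBATIM (same `∀β` onset-floor antecedent, same sub-onset guard, same on-axis mirror pairs `t ∈ [2R+2, L]`, `Rs ≤ ℓ₄`,
`4R+8 ≤ L`) with TWO changes: (i) the test scale `s` is PINNED to the onset — the extra hypothesis that `s` ITSELF carries the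
`∀L`-floors of level `ε` (so the admissible scales are no longer upward closed: `s` lies within one octave of the top of the
floor window; idea-crit-9 #95 (C3) showed that without the pin the slack can be tested away at `s' := min 1 (ℓ₄/R)`);
(ii) the conclusion is TEMPERED: `|c_{q,k}(t)| ≤ (C/R⁴)² · (ℓ₄/(R s))^M` for SOME `M : ℕ`.  `26791 ⇒ E_T` (`M = 0`, pin
ignored: `pinnedTempered_of_axisMirror`); `E_T ⇏ 26791` by rescaling, because `ℓ₄/R` carries no floors. -/
def PinnedTemperedCeiling : Prop :=
  ∀ (G : Type) [Group G] [TopologicalSpace G] [IsTopologicalGroup G] [CompactSpace G],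
    IsCompactSimpleLieGroup G → Nonempty (G ≃ₜ* Matrix.specialUnitaryGroup (Fin 2) ℂ) →
    letI : MeasurableSpace G := borel G
    haveI : BorelSpace G := ⟨rfl⟩
    ∀ (r : LatticeRep G) (v f g h : SchwartzMap (EuclideanSpace ℝ (Fin 4)) ℝ) (Λ₅ : ℝ), ∃ ε₀ : ℝ, 0 < ε₀ ∧
      ∀ ε : ℝ, 0 < ε → ε ≤ ε₀ →
        (∃ β₅ : ℝ, ∀ β : ℝ, β₅ ≤ β → ∃ s : ℝ, 0 < s ∧ s ≤ 1 ∧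
            (∀ L : ℕ, Λ₅ ≤ s * L → ε ≤ Q2 G r β L s (thetaTest 4 v) v) ∧
            (∀ L : ℕ, Λ₅ ≤ s * L → ε ≤ |Q3 G r β L s f g h|)) →
        ∃ (M : ℕ) (C ℓ₄ β₄ : ℝ), 0 < ℓ₄ ∧ 0 ≤ C ∧ ∀ β : ℝ, β₄ ≤ β → ∀ s : ℝ, 0 < s → s ≤ 1 →
          (∀ s' : ℝ, 2 * s ≤ s' → s' ≤ 1 →
            ¬ ((∀ L : ℕ, Λ₅ ≤ s' * L → ε ≤ Q2 G r β L s' (thetaTest 4 v) v) ∧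
               (∀ L : ℕ, Λ₅ ≤ s' * L → ε ≤ |Q3 G r β L s' f g h|))) →
          ((∀ L : ℕ, Λ₅ ≤ s * L → ε ≤ Q2 G r β L s (thetaTest 4 v) v) ∧
            (∀ L : ℕ, Λ₅ ≤ s * L → ε ≤ |Q3 G r β L s f g h|)) →
          ∀ (L : ℕ) (q : Fin 4 × Fin 4) (k : Fin 4) (R t : ℕ), q.1 < q.2 → 1 ≤ R → (R : ℝ) * s ≤ ℓ₄ →
            4 * R + 8 ≤ L → 2 * R + 2 ≤ t → t ≤ L →
            |torusE G r β L (fun U =>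
                (plane G r q (fun i => if i = k then (t : ℤ) else 0) U -
                    torusE G r β L (plane G r q (fun i => if i = k then (t : ℤ) else 0))) *
                  (plane G r q (fun _ => 0) U - torusE G r β L (plane G r q (fun _ => 0))))| ≤
              (C / (R : ℝ) ^ 4) ^ 2 * (ℓ₄ / ((R : ℝ) * s)) ^ M

/-- **TAC-K `TemperedAtomCeilingsK`** (REV 2 of `TemperedCalibratedUnitK`; answers #95 (C1)) — the calibrated unit `a(β)`
(floors `LowerBoundsK G r a`, `a β ≤ 1`) together with TEMPERED ATOM CEILINGS IN CEILING FORM AT THE ATOM'S OWN SCALE: in every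
odd-torus limit state at `β ≥ β₇`, every single-orientation `b`-atom of scale `s > a β` (finer than the unit) lying on one side
of a lattice hyperplane `x_k = c` at lattice distance `≥ t/s + 2` from its carrier has reflected two-body square
`≤ ε · (s / a β)^M` — E1's conclusion (`AtomCeilings`, all axes ∕ planes ∕ offsets, far mirrors) with the level GROWING
polynomially toward the UV.  `M = 0` at fixed level is what `MirrorCalibratedUnitK` + the landed E1 give
(`temperedAtomCeilingsK_of_mirror`); the converse fails (the level is scale-dependent and the mirror regime is E1's, not the
onset set's). -/
def TemperedAtomCeilingsK : Prop :=
  ∀ (G : Type) [Group G] [TopologicalSpace G] [IsTopologicalGroup G] [CompactSpace G],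
    IsCompactSimpleLieGroup G → Nonempty (G ≃ₜ* Matrix.specialUnitaryGroup (Fin 2) ℂ) →
    letI : MeasurableSpace G := borel G
    haveI : BorelSpace G := ⟨rfl⟩
    ∃ (r : LatticeRep G) (a : ℝ → ℝ) (b : SchwartzMap (EuclideanSpace ℝ (Fin 4)) ℝ) (ε : ℝ) (M : ℕ),
      IsAdmissibleProfile b ∧ 0 < ε ∧ (∀ β, 0 < a β) ∧ Tendsto a atTop (nhds 0) ∧ LowerBoundsK G r a ∧
      ∃ β₇ : ℝ, ∀ β : ℝ, β₇ ≤ β → a β ≤ 1 ∧ ∀ μ ∈ oddTorusLimitPoints r β,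
          ∀ (S : Finset ((Fin 4 × Fin 4) × (Fin 4 → ℤ))) (q : Fin 4 × Fin 4) (s t : ℝ) (y : EuclideanSpace ℝ (Fin 4))
            (k : Fin 4) (c : ℤ), q.1 < q.2 → 0 < s → a β < s → (∀ u, b u ≠ 0 → ‖u‖ ≤ t) →
            (∀ p, atomWt b {q} s y p ≠ 0 → p ∈ S) →
            ((∀ p ∈ S, ((p.2 k : ℤ) : ℝ) + t / s + 2 ≤ (c : ℝ)) ∨ (∀ p ∈ S, (c : ℝ) + t / s + 2 ≤ ((p.2 k : ℤ) : ℝ))) →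
            ∑ p ∈ S, ∑ p' ∈ S, atomWt b {q} s y p * atomWt b {q} s y p' *
                stateMomentStr G r μ 2 ![p.1, p'.1] ![reflSite k c p, p'.2] ≤ ε * (s / a β) ^ M

/-- **E3T `TemperedMomentBoundA`** (REV 2 of `TemperedMomentBound`; answers #95 (C2)) — `SmearedMomentBound` (E3 currency) with its
onset-domination hypothesis REPLACED by tempered atom ceilings in ceiling form at the atom's own scale (level `ε (s/a)^M` for
atoms of scale `s > a`, far mirrors, all axes), for every `M` (constants may depend on `M`); conclusion character for character
the leaf's DATA functional bound.  `⇒ SmearedMomentBound` via the landed E1 (`smearedMomentBound_of_temperedA`). -/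
def TemperedMomentBoundA : Prop :=
  ∀ (M : ℕ) (G : Type) [Group G] [TopologicalSpace G] [IsTopologicalGroup G] [CompactSpace G],
    IsCompactSimpleLieGroup G → Nonempty (G ≃ₜ* Matrix.specialUnitaryGroup (Fin 2) ℂ) →
    letI : MeasurableSpace G := borel G
    haveI : BorelSpace G := ⟨rfl⟩
    ∀ (r : LatticeRep G) (b : SchwartzMap (EuclideanSpace ℝ (Fin 4)) ℝ) (ε : ℝ), IsAdmissibleProfile b → 0 < ε →
      ∃ (c : ℕ → ℝ) (N : ℕ) (α C γ β₄ : ℝ), (∀ n, 0 ≤ c n ∧ c n ≤ α * C ^ n * (n.factorial : ℝ) ^ γ) ∧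
        ∀ β : ℝ, β₄ ≤ β → ∀ μ ∈ oddTorusLimitPoints r β, ∀ a : ℝ, 0 < a → a ≤ 1 →
          (∀ (S : Finset ((Fin 4 × Fin 4) × (Fin 4 → ℤ))) (q : Fin 4 × Fin 4) (s t : ℝ) (y : EuclideanSpace ℝ (Fin 4))
            (k : Fin 4) (c : ℤ), q.1 < q.2 → 0 < s → a < s → (∀ u, b u ≠ 0 → ‖u‖ ≤ t) →
            (∀ p, atomWt b {q} s y p ≠ 0 → p ∈ S) →
            ((∀ p ∈ S, ((p.2 k : ℤ) : ℝ) + t / s + 2 ≤ (c : ℝ)) ∨ (∀ p ∈ S, (c : ℝ) + t / s + 2 ≤ ((p.2 k : ℤ) : ℝ))) →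
            ∑ p ∈ S, ∑ p' ∈ S, atomWt b {q} s y p * atomWt b {q} s y p' *
                stateMomentStr G r μ 2 ![p.1, p'.1] ![reflSite k c p, p'.2] ≤ ε * (s / a) ^ M) →
          ∀ (n : ℕ) (q : Fin n → Fin 4 × Fin 4), 2 ≤ n → (∀ i, (q i).1 < (q i).2) →
            ∀ F : SchwartzMap (Fin n → EuclideanSpace ℝ (Fin 4)) ℂ, IsOffDiagonal F →
              ‖∑' x : Fin n → (Fin 4 → ℤ), ((stateMomentStr G r μ n q x : ℝ) : ℂ) *
                  F (fun l => a • siteToE (x l) +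
                    (a / 2) • (EuclideanSpace.single (q l).1 (1 : ℝ) + EuclideanSpace.single (q l).2 (1 : ℝ)))‖ ≤
                c n * schwartzNorm (N * n) F

/-- **W `WhitneyPkgW`** — the off-diagonal Whitney package E2 (`WhitneyPkg`, landed `stub_offDiagonalWhitney`) WITH WEIGHTS:
for every loss exponent `K₀` the pieces may be chosen so that the WEIGHTED mass `Σ_j M_j / ρ_j^{K₀ n}` obeys the same
E0′-compatible bound `≤ α Cⁿ (n!)^γ ‖F‖_{Nn}` (flatness of `⁰𝒮` at the fat diagonal to order `K + K₀ n`; all other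
clauses character for character E2).  `⇒ WhitneyPkg` (`K₀ = 0`, `whitneyPkg_of_W`). -/
def WhitneyPkgW : Prop :=
  ∀ (Λ : ℝ) (N' K₀ : ℕ), 1 ≤ Λ → ∃ (N : ℕ) (α C γ : ℝ), 0 ≤ α ∧ 0 ≤ C ∧ 0 ≤ γ ∧ ∀ (n : ℕ), 1 ≤ n →
    ∀ F : SchwartzMap (Fin n → EuclideanSpace ℝ (Fin 4)) ℂ, IsOffDiagonal F →
      ∃ (κ : ℕ → ℂ) (Gp : ℕ → SchwartzMap (Fin n → EuclideanSpace ℝ (Fin 4)) ℝ)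
        (cp : ℕ → Fin n → EuclideanSpace ℝ (Fin 4)) (ρ M : ℕ → ℝ),
        (∀ j, ‖κ j‖ ≤ 1) ∧ (∀ j, 0 < ρ j ∧ ρ j ≤ 1 / 2) ∧
        (∀ j, tsupport (Gp j) ⊆ {z | ∀ l, ‖z l - cp j l‖ ≤ ρ j}) ∧
        (∀ j (l l' : Fin n), l ≠ l' → ∃ k : Fin 4, Λ * ρ j ≤ |cp j l k - cp j l' k|) ∧
        (∀ j (m : ℕ), m ≤ N' * n → ∀ z, ‖iteratedFDeriv ℝ m (Gp j) z‖ ≤ M j / ρ j ^ m) ∧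
        (∀ j, 0 ≤ M j) ∧ Summable M ∧
        ∑' j, M j ≤ α * C ^ n * (n.factorial : ℝ) ^ γ * schwartzNorm (N * n) F ∧
        Summable (fun j => M j / ρ j ^ (K₀ * n)) ∧
        ∑' j, M j / ρ j ^ (K₀ * n) ≤ α * C ^ n * (n.factorial : ℝ) ^ γ * schwartzNorm (N * n) F ∧
        ∀ z, HasSum (fun j => κ j * ((Gp j z : ℝ) : ℂ)) (F z)

/-- **D1 `PinnedTopOctaveCeiling`** (REV 2 of `TopOctaveCeiling`: pinned test scale) — E_T's conclusion owed ONLY at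
NON-DOUBLABLE scales: the top octave(s) below the pinned onset scale, `κ ℓ₄ < R s (≤ ℓ₄)` for every fixed `κ ∈ (0,1]`
(constants `M, C, β₄` may depend on `κ`; `ℓ₄` is chosen first), or the top octave of the odd torus, `L < 8R + 8`
(finite-size twin).  Same antecedent, guard AND PIN as E_T.  `E_T ⇒ D1` (`pinnedTopOctave_of_tempered`); with D2 it gives
E_T back (`pinnedTempered_of_octaves`).  [E-wall n = 2 on ONE octave at the onset; the wall, narrowed] -/
def PinnedTopOctaveCeiling : Prop :=
  ∀ (G : Type) [Group G] [TopologicalSpace G] [IsTopologicalGroup G] [CompactSpace G],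
    IsCompactSimpleLieGroup G → Nonempty (G ≃ₜ* Matrix.specialUnitaryGroup (Fin 2) ℂ) →
    letI : MeasurableSpace G := borel G
    haveI : BorelSpace G := ⟨rfl⟩
    ∀ (r : LatticeRep G) (v f g h : SchwartzMap (EuclideanSpace ℝ (Fin 4)) ℝ) (Λ₅ : ℝ), ∃ ε₀ : ℝ, 0 < ε₀ ∧
      ∀ ε : ℝ, 0 < ε → ε ≤ ε₀ →
        (∃ β₅ : ℝ, ∀ β : ℝ, β₅ ≤ β → ∃ s : ℝ, 0 < s ∧ s ≤ 1 ∧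
            (∀ L : ℕ, Λ₅ ≤ s * L → ε ≤ Q2 G r β L s (thetaTest 4 v) v) ∧
            (∀ L : ℕ, Λ₅ ≤ s * L → ε ≤ |Q3 G r β L s f g h|)) →
        ∃ ℓ₄ : ℝ, 0 < ℓ₄ ∧ ∀ κ : ℝ, 0 < κ → κ ≤ 1 →
        ∃ (M : ℕ) (C β₄ : ℝ), 0 ≤ C ∧ ∀ β : ℝ, β₄ ≤ β → ∀ s : ℝ, 0 < s → s ≤ 1 →
          (∀ s' : ℝ, 2 * s ≤ s' → s' ≤ 1 →
            ¬ ((∀ L : ℕ, Λ₅ ≤ s' * L → ε ≤ Q2 G r β L s' (thetaTest 4 v) v) ∧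
               (∀ L : ℕ, Λ₅ ≤ s' * L → ε ≤ |Q3 G r β L s' f g h|))) →
          ((∀ L : ℕ, Λ₅ ≤ s * L → ε ≤ Q2 G r β L s (thetaTest 4 v) v) ∧
            (∀ L : ℕ, Λ₅ ≤ s * L → ε ≤ |Q3 G r β L s f g h|)) →
          ∀ (L : ℕ) (q : Fin 4 × Fin 4) (k : Fin 4) (R t : ℕ), q.1 < q.2 → 1 ≤ R → (R : ℝ) * s ≤ ℓ₄ →
            4 * R + 8 ≤ L → (κ * ℓ₄ < (R : ℝ) * s ∨ L < 8 * R + 8) → 2 * R + 2 ≤ t → t ≤ L →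
            |torusE G r β L (fun U =>
                (plane G r q (fun i => if i = k then (t : ℤ) else 0) U -
                    torusE G r β L (plane G r q (fun i => if i = k then (t : ℤ) else 0))) *
                  (plane G r q (fun _ => 0) U - torusE G r β L (plane G r q (fun _ => 0))))| ≤
              (C / (R : ℝ) ^ 4) ^ 2 * (ℓ₄ / ((R : ℝ) * s)) ^ M

/-- **D2 `PinnedOctaveStep`** (REV 2 of `MirrorOctaveStep`: pinned test scale) — ULTRAVIOLET-WARD OCTAVE REGULARITY of the
on-axis mirror covariance strictly below the pinned onset scale (`2Rs ≤ ℓ₄`) and inside the torus (`8R+8 ≤ L`): a bound `B`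
on `|c(t')|` over the doubled octave `t' ∈ [4R+2, L]` gives `|c(t)| ≤ K · max(B, (C₀/R⁴)²)` on `t ∈ [2R+2, L]`, for SOME
β-uniform `K ≥ 1`, `C₀ ≥ 0` — `R⁸c(R)` grows by at most a factor `K` per octave toward the UV unless it is below the
hyperscaling size `C₀²`.  `26791 ⇒ D2` with `K = 1` (`pinnedOctaveStep_of_axisMirror`).  [multiscale ∕ RG regularity;
measurable octave by octave] -/
def PinnedOctaveStep : Prop :=
  ∀ (G : Type) [Group G] [TopologicalSpace G] [IsTopologicalGroup G] [CompactSpace G],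
    IsCompactSimpleLieGroup G → Nonempty (G ≃ₜ* Matrix.specialUnitaryGroup (Fin 2) ℂ) →
    letI : MeasurableSpace G := borel G
    haveI : BorelSpace G := ⟨rfl⟩
    ∀ (r : LatticeRep G) (v f g h : SchwartzMap (EuclideanSpace ℝ (Fin 4)) ℝ) (Λ₅ : ℝ), ∃ ε₀ : ℝ, 0 < ε₀ ∧
      ∀ ε : ℝ, 0 < ε → ε ≤ ε₀ →
        (∃ β₅ : ℝ, ∀ β : ℝ, β₅ ≤ β → ∃ s : ℝ, 0 < s ∧ s ≤ 1 ∧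
            (∀ L : ℕ, Λ₅ ≤ s * L → ε ≤ Q2 G r β L s (thetaTest 4 v) v) ∧
            (∀ L : ℕ, Λ₅ ≤ s * L → ε ≤ |Q3 G r β L s f g h|)) →
        ∃ (K C₀ ℓ₄ β₄ : ℝ), 0 < ℓ₄ ∧ 1 ≤ K ∧ 0 ≤ C₀ ∧ ∀ β : ℝ, β₄ ≤ β → ∀ s : ℝ, 0 < s → s ≤ 1 →
          (∀ s' : ℝ, 2 * s ≤ s' → s' ≤ 1 →
            ¬ ((∀ L : ℕ, Λ₅ ≤ s' * L → ε ≤ Q2 G r β L s' (thetaTest 4 v) v) ∧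
               (∀ L : ℕ, Λ₅ ≤ s' * L → ε ≤ |Q3 G r β L s' f g h|))) →
          ((∀ L : ℕ, Λ₅ ≤ s * L → ε ≤ Q2 G r β L s (thetaTest 4 v) v) ∧
            (∀ L : ℕ, Λ₅ ≤ s * L → ε ≤ |Q3 G r β L s f g h|)) →
          ∀ (L : ℕ) (q : Fin 4 × Fin 4) (k : Fin 4) (R : ℕ) (B : ℝ), q.1 < q.2 → 1 ≤ R → 2 * (R : ℝ) * s ≤ ℓ₄ →
            8 * R + 8 ≤ L →
            (∀ t' : ℕ, 4 * R + 2 ≤ t' → t' ≤ L →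
              |torusE G r β L (fun U =>
                (plane G r q (fun i => if i = k then (t' : ℤ) else 0) U -
                    torusE G r β L (plane G r q (fun i => if i = k then (t' : ℤ) else 0))) *
                  (plane G r q (fun _ => 0) U - torusE G r β L (plane G r q (fun _ => 0))))| ≤ B) →
            ∀ t : ℕ, 2 * R + 2 ≤ t → t ≤ L →
            |torusE G r β L (fun U =>
                (plane G r q (fun i => if i = k then (t : ℤ) else 0) U -
                    torusE G r β L (plane G r q (fun i => if i = k then (t : ℤ) else 0))) *
                  (plane G r q (fun _ => 0) U - torusE G r β L (plane G r q (fun _ => 0))))| ≤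
              K * max B ((C₀ / (R : ℝ) ^ 4) ^ 2)

/-! ## §2 The wuc certificates and the glue (sorry-free) -/

/-- `26791 ⇒ E_T`: take `M = 0` and ignore the pin. [wuc certificate] -/
theorem pinnedTempered_of_axisMirror (hA : AxisMirrorCeiling) : PinnedTemperedCeiling := by
  intro G _ _ _ _ hG hcl
  letI : MeasurableSpace G := borel G
  haveI : BorelSpace G := ⟨rfl⟩
  intro r v f g h' Λ₅
  obtain ⟨ε₀, hε₀, hh⟩ := hA G hG hcl r v f g h' Λ₅
  refine ⟨ε₀, hε₀, fun ε hε hεε hfl => ?_⟩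
  obtain ⟨C, ℓ₄, β₄, hℓ₄, hC, hmain⟩ := hh ε hε hεε hfl
  refine ⟨0, C, ℓ₄, β₄, hℓ₄, hC, ?_⟩
  intro β hβ s hs hs1 hsub _hpin L q k R t hq hR hRs hL hRt htL
  simpa only [pow_zero, mul_one] using hmain β hβ s hs hs1 hsub L q k R t hq hR hRs hL hRt htL

/-- `MirrorCalibratedUnitK ⇒ TemperedAtomCeilingsK`: `M = 0`, the ceiling form supplied by the LANDED E1 `atomCeilings_holds`.
[wuc certificate] -/
theorem temperedAtomCeilingsK_of_mirror (hU : MirrorCalibratedUnitK) : TemperedAtomCeilingsK := by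
  intro G _ _ _ _ hG hcl
  letI : MeasurableSpace G := borel G
  haveI : BorelSpace G := ⟨rfl⟩
  obtain ⟨r, a, b, ε, hb, hε, hapos, ha0, hLB, β₇, hβ₇⟩ := hU G hG hcl
  refine ⟨r, a, b, ε, 0, hb, hε, hapos, ha0, hLB, max β₇ 0, fun β hβ => ⟨(hβ₇ β (le_of_max_le_left hβ)).1, ?_⟩⟩
  intro μ hμ S q s t y k c hq hs has ht hS hfar
  have hE1 := atomCeilings_holds G hG hcl r b ε β (a β) μ hb hε (le_of_max_le_right hβ) hμ
    ((hβ₇ β (le_of_max_le_left hβ)).2 μ hμ) S q s t y k c hq hs has ht hS hfar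
  simpa only [pow_zero, mul_one] using hE1

/-- `TemperedMomentBoundA ⇒ SmearedMomentBound`: at `M = 0` the ceiling-form hypothesis follows from onset domination by the
LANDED E1. [wuc certificate] -/
theorem smearedMomentBound_of_temperedA (hT : TemperedMomentBoundA) : SmearedMomentBound := by
  intro G _ _ _ _ hG hcl
  letI : MeasurableSpace G := borel G
  haveI : BorelSpace G := ⟨rfl⟩
  intro r b ε hb hε
  obtain ⟨c, N, α, C, γ, β₄, hc, hbd⟩ := hT 0 G hG hcl r b ε hb hε
  refine ⟨c, N, α, C, γ, max β₄ 0, hc, ?_⟩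
  intro β hβ μ hμ a ha ha1 hons n q hn hq F hF
  refine hbd β (le_of_max_le_left hβ) μ hμ a ha ha1 ?_ n q hn hq F hF
  intro S q' s t y k c' hq' hs has ht hS hfar
  have hE1 := atomCeilings_holds G hG hcl r b ε β a μ hb hε (le_of_max_le_right hβ) hμ hons
    S q' s t y k c' hq' hs has ht hS hfar
  simpa only [pow_zero, mul_one] using hE1

/-- `WhitneyPkgW ⇒ WhitneyPkg` (`K₀ = 0`, forget the weighted clauses). [bookkeeping] -/
theorem whitneyPkg_of_W (hW : WhitneyPkgW) : WhitneyPkg := by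
  intro Λ N' hΛ
  obtain ⟨N, α, C, γ, hα, hC, hγ, hh⟩ := hW Λ N' 0 hΛ
  refine ⟨N, α, C, γ, hα, hC, hγ, fun n hn F hF => ?_⟩
  obtain ⟨κ, Gp, cp, ρ, M, h1, h2, h3, h4, h5, h6, h7, h8, -, -, h9⟩ := hh n hn F hF
  exact ⟨κ, Gp, cp, ρ, M, h1, h2, h3, h4, h5, h6, h7, h8, h9⟩

/-- **Glue (pure logic)** — the calibrated unit with tempered atom ceilings and the tempered moment bound at ITS exponent `M`
assemble the K-input package of the landed smeared engine (twin of K1's `smearedIVInputK_of`). -/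
theorem smearedIVInputK_of_temperedA (hU : TemperedAtomCeilingsK) (hS : TemperedMomentBoundA) : SmearedIVInputK := by
  intro G _ _ _ _ hG hcl
  letI : MeasurableSpace G := borel G
  haveI : BorelSpace G := ⟨rfl⟩
  obtain ⟨r, a, b, ε, M, hb, hε, hapos, ha0, hLB, β₇, hβ₇⟩ := hU G hG hcl
  obtain ⟨c, N, α, C, γ, β₄, hc, hbd⟩ := hS M G hG hcl r b ε hb hε
  refine ⟨r, a, c, N, α, C, γ, max β₄ β₇, hapos, ha0, hLB, hc, ?_⟩
  intro β hβ μ hμ n q hn hq F hF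
  exact hbd β (le_of_max_le_left hβ) μ hμ (a β) (hapos β) (hβ₇ β (le_of_max_le_right hβ)).1
    ((hβ₇ β (le_of_max_le_right hβ)).2 μ hμ) n q hn hq F hF

/-! ## §2b The dyadic reduction `D1 → D2 → E_T` (sorry-free; REV 2: the pin passes through) -/

/-- **Octave induction (pure real analysis).**  `c : ℕ → ℝ` any function of the separation; D1-type anchor on the
non-doublable scales, D2-type step on the doublable ones; conclusion: the tempered envelope at every admissible scale.
Strong induction on `L − R`. -/
theorem octave_induction {c : ℕ → ℝ} {L M₁ M : ℕ} {s ℓ ℓ₁ ℓ₂ κ K C₀ C₁ A : ℝ}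
    (hs : 0 < s) (hℓ : 0 < ℓ) (hℓ1 : ℓ ≤ ℓ₁) (hℓ2 : ℓ ≤ ℓ₂) (hκ : 2 * (κ * ℓ₁) ≤ ℓ)
    (hK : 1 ≤ K) (hKM : K ≤ 2 ^ M) (hM : M₁ ≤ M)
    (hA1 : C₁ ^ 2 * (ℓ₁ / ℓ) ^ M₁ ≤ A) (hA2 : K * C₀ ^ 2 ≤ A)
    (hD1 : ∀ R t : ℕ, 1 ≤ R → (R : ℝ) * s ≤ ℓ₁ → 4 * R + 8 ≤ L → (κ * ℓ₁ < (R : ℝ) * s ∨ L < 8 * R + 8) →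
      2 * R + 2 ≤ t → t ≤ L → c t ≤ (C₁ / (R : ℝ) ^ 4) ^ 2 * (ℓ₁ / ((R : ℝ) * s)) ^ M₁)
    (hD2 : ∀ (R : ℕ) (B : ℝ), 1 ≤ R → 2 * (R : ℝ) * s ≤ ℓ₂ → 8 * R + 8 ≤ L →
      (∀ t' : ℕ, 4 * R + 2 ≤ t' → t' ≤ L → c t' ≤ B) →
      ∀ t : ℕ, 2 * R + 2 ≤ t → t ≤ L → c t ≤ K * max B ((C₀ / (R : ℝ) ^ 4) ^ 2)) :
    ∀ R t : ℕ, 1 ≤ R → (R : ℝ) * s ≤ ℓ → 4 * R + 8 ≤ L → 2 * R + 2 ≤ t → t ≤ L →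
      c t ≤ A / (R : ℝ) ^ 8 * (ℓ / ((R : ℝ) * s)) ^ M := by
  have hK0 : 0 ≤ K := zero_le_one.trans hK
  have hA0 : 0 ≤ A := le_trans (by positivity) hA2
  -- the claim, by strong induction on `L - R`
  suffices key : ∀ n : ℕ, ∀ R : ℕ, L - R = n → 1 ≤ R → (R : ℝ) * s ≤ ℓ → 4 * R + 8 ≤ L →
      ∀ t : ℕ, 2 * R + 2 ≤ t → t ≤ L → c t ≤ A / (R : ℝ) ^ 8 * (ℓ / ((R : ℝ) * s)) ^ M by
    intro R t hR hRs hL ht htL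
    exact key (L - R) R rfl hR hRs hL t ht htL
  intro n
  induction n using Nat.strong_induction_on with
  | _ n ih =>
    intro R hn hR hRs hL t ht htL
    have hr : (0 : ℝ) < R := by exact_mod_cast hR
    have hrs : 0 < (R : ℝ) * s := mul_pos hr hs
    have hone : 1 ≤ ℓ / ((R : ℝ) * s) := (one_le_div hrs).mpr hRs
    have hpowM : 1 ≤ (ℓ / ((R : ℝ) * s)) ^ M := one_le_pow₀ hone
    have hT0 : 0 ≤ A / (R : ℝ) ^ 8 * (ℓ / ((R : ℝ) * s)) ^ M := by positivity
    by_cases hdbl : 2 * (R : ℝ) * s ≤ ℓ ∧ 8 * R + 8 ≤ L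
    · -- doublable: step D2 with `B :=` the envelope at `2R`, supplied by the induction hypothesis
      obtain ⟨h2Rs, h8⟩ := hdbl
      have hB : ∀ t' : ℕ, 4 * R + 2 ≤ t' → t' ≤ L →
          c t' ≤ A / ((2 * R : ℕ) : ℝ) ^ 8 * (ℓ / (((2 * R : ℕ) : ℝ) * s)) ^ M := by
        intro t' ht' ht'L
        refine ih (L - 2 * R) (by omega) (2 * R) rfl (by omega) ?_ (by omega) t' (by omega) ht'L
        push_cast; linarith
      have hstep := hD2 R _ hR (h2Rs.trans hℓ2) h8 hB t ht htL
      refine hstep.trans ?_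
      rw [mul_max_of_nonneg _ _ hK0]
      refine max_le ?_ ?_
      · -- `K · T(2R) ≤ T(R)` because `K ≤ 2^M ≤ 2^(8+M)`
        have hcast : ((2 * R : ℕ) : ℝ) = 2 * (R : ℝ) := by push_cast; ring
        rw [hcast]
        have h1 : A / (2 * (R : ℝ)) ^ 8 * (ℓ / (2 * (R : ℝ) * s)) ^ M =
            (A / (R : ℝ) ^ 8 * (ℓ / ((R : ℝ) * s)) ^ M) * (K / ((2 : ℝ) ^ 8 * 2 ^ M)) * K⁻¹ := by
          have hK' : K ≠ 0 := ne_of_gt (lt_of_lt_of_le one_pos hK)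
          rw [show ℓ / (2 * (R : ℝ) * s) = ℓ / ((R : ℝ) * s) / 2 by ring, div_pow, mul_pow]
          field_simp
        rw [h1]
        have h2 : K / ((2 : ℝ) ^ 8 * 2 ^ M) ≤ 1 := by
          rw [div_le_one (by positivity)]
          calc K ≤ 2 ^ M := hKM
            _ = 1 * 2 ^ M := by ring
            _ ≤ (2 : ℝ) ^ 8 * 2 ^ M := by gcongr; norm_num
        have hK' : K ≠ 0 := ne_of_gt (lt_of_lt_of_le one_pos hK)
        calc K * (A / (R : ℝ) ^ 8 * (ℓ / ((R : ℝ) * s)) ^ M * (K / ((2 : ℝ) ^ 8 * 2 ^ M)) * K⁻¹)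
            = (A / (R : ℝ) ^ 8 * (ℓ / ((R : ℝ) * s)) ^ M) * (K / ((2 : ℝ) ^ 8 * 2 ^ M)) := by
              field_simp
          _ ≤ (A / (R : ℝ) ^ 8 * (ℓ / ((R : ℝ) * s)) ^ M) * 1 := by gcongr
          _ = A / (R : ℝ) ^ 8 * (ℓ / ((R : ℝ) * s)) ^ M := mul_one _
      · -- `K · (C₀/R⁴)² ≤ A/R⁸ ≤ T(R)`
        have h1 : K * (C₀ / (R : ℝ) ^ 4) ^ 2 = K * C₀ ^ 2 / (R : ℝ) ^ 8 := by
          rw [div_pow, ← pow_mul]; ring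
        rw [h1]
        calc K * C₀ ^ 2 / (R : ℝ) ^ 8 ≤ A / (R : ℝ) ^ 8 := by gcongr
          _ = A / (R : ℝ) ^ 8 * 1 := (mul_one _).symm
          _ ≤ A / (R : ℝ) ^ 8 * (ℓ / ((R : ℝ) * s)) ^ M := by gcongr
    · -- non-doublable: anchor D1
      have hoct : κ * ℓ₁ < (R : ℝ) * s ∨ L < 8 * R + 8 := by
        by_cases h8 : 8 * R + 8 ≤ L
        · left
          have : ℓ < 2 * (R : ℝ) * s := not_le.1 fun h => hdbl ⟨h, h8⟩
          linarith
        · right; omega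
      have hanc := hD1 R t hR (hRs.trans hℓ1) hL hoct ht htL
      refine hanc.trans ?_
      have hℓne : ℓ ≠ 0 := ne_of_gt hℓ
      have h1 : ℓ₁ / ((R : ℝ) * s) = (ℓ₁ / ℓ) * (ℓ / ((R : ℝ) * s)) := by
        field_simp
      have h2 : (ℓ₁ / ((R : ℝ) * s)) ^ M₁ ≤ (ℓ₁ / ℓ) ^ M₁ * (ℓ / ((R : ℝ) * s)) ^ M := by
        rw [h1, mul_pow]
        exact mul_le_mul_of_nonneg_left (pow_le_pow_right₀ hone hM)
          (pow_nonneg (div_nonneg (hℓ.le.trans hℓ1) hℓ.le) _)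
      have h3 : (C₁ / (R : ℝ) ^ 4) ^ 2 = C₁ ^ 2 / (R : ℝ) ^ 8 := by
        rw [div_pow, ← pow_mul]
      rw [h3]
      calc C₁ ^ 2 / (R : ℝ) ^ 8 * (ℓ₁ / ((R : ℝ) * s)) ^ M₁
          ≤ C₁ ^ 2 / (R : ℝ) ^ 8 * ((ℓ₁ / ℓ) ^ M₁ * (ℓ / ((R : ℝ) * s)) ^ M) := by gcongr
        _ = (C₁ ^ 2 * (ℓ₁ / ℓ) ^ M₁) / (R : ℝ) ^ 8 * (ℓ / ((R : ℝ) * s)) ^ M := by ring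
        _ ≤ A / (R : ℝ) ^ 8 * (ℓ / ((R : ℝ) * s)) ^ M := by gcongr

/-- **`D1 → D2 → E_T`** — the dyadic reduction of the sister line's load-bearing stub (REV 2, pinned), PROVED: `ε₀ := min`,
`ℓ₄ := min ℓ₄¹ ℓ₄²`, `κ := ℓ₄/(2ℓ₄¹)`, `M := max M₁ M₂` with `K ≤ 2^{M₂}`, `C := √max(C₁²(ℓ₄¹/ℓ₄)^{M₁}, K C₀²)`,
`β₄ := max`. -/
theorem pinnedTempered_of_octaves (hD1 : PinnedTopOctaveCeiling) (hD2 : PinnedOctaveStep) :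
    PinnedTemperedCeiling := by
  intro G _ _ _ _ hG hcl
  letI : MeasurableSpace G := borel G
  haveI : BorelSpace G := ⟨rfl⟩
  intro r v f g h' Λ₅
  obtain ⟨ε₁, hε₁, H1⟩ := hD1 G hG hcl r v f g h' Λ₅
  obtain ⟨ε₂, hε₂, H2⟩ := hD2 G hG hcl r v f g h' Λ₅
  refine ⟨min ε₁ ε₂, lt_min hε₁ hε₂, fun ε hε hεε hfl => ?_⟩
  obtain ⟨ℓ₁, hℓ₁, H1'⟩ := H1 ε hε (hεε.trans (min_le_left _ _)) hfl
  obtain ⟨K, C₀, ℓ₂, β₂, hℓ₂, hK, hC₀, H2'⟩ := H2 ε hε (hεε.trans (min_le_right _ _)) hfl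
  have hℓ : 0 < min ℓ₁ ℓ₂ := lt_min hℓ₁ hℓ₂
  have hκpos : 0 < min ℓ₁ ℓ₂ / (2 * ℓ₁) := by positivity
  have hκle : min ℓ₁ ℓ₂ / (2 * ℓ₁) ≤ 1 := by
    rw [div_le_one (by positivity)]
    linarith [min_le_left ℓ₁ ℓ₂]
  obtain ⟨M₁, C₁, β₁, hC₁, H1''⟩ := H1' (min ℓ₁ ℓ₂ / (2 * ℓ₁)) hκpos hκle
  obtain ⟨M₂, hM₂⟩ := pow_unbounded_of_one_lt K (by norm_num : (1 : ℝ) < 2)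
  set ℓ := min ℓ₁ ℓ₂ with hℓdef
  set M := max M₁ M₂ with hMdef
  set A := max (C₁ ^ 2 * (ℓ₁ / ℓ) ^ M₁) (K * C₀ ^ 2) with hAdef
  have hA0 : 0 ≤ A := le_trans (by positivity) (le_max_right _ _)
  have hKM : K ≤ 2 ^ M := hM₂.le.trans (pow_le_pow_right₀ (by norm_num) (le_max_right _ _))
  refine ⟨M, Real.sqrt A, ℓ, max β₁ β₂, hℓ, Real.sqrt_nonneg _, ?_⟩
  intro β hβ s hs hs1 hsub hpin L q k R t hq hR hRs hL hRt htL
  have hmain := octave_induction (L := L) (κ := ℓ / (2 * ℓ₁))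
    (c := fun t : ℕ => |torusE G r β L (fun U =>
        (plane G r q (fun i => if i = k then (t : ℤ) else 0) U -
            torusE G r β L (plane G r q (fun i => if i = k then (t : ℤ) else 0))) *
          (plane G r q (fun _ => 0) U - torusE G r β L (plane G r q (fun _ => 0))))|)
    hs hℓ (min_le_left _ _) (min_le_right _ _) (le_of_eq (by field_simp)) hK hKM (le_max_left _ _)
    (le_max_left _ _) (le_max_right _ _)
    (fun R' t' h1 h2 h3 h4 h5 h6 =>
      H1'' β (le_of_max_le_left hβ) s hs hs1 hsub hpin L q k R' t' hq h1 h2 h3 h4 h5 h6)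
    (fun R' B h1 h2 h3 hB t' h5 h6 =>
      H2' β (le_of_max_le_right hβ) s hs hs1 hsub hpin L q k R' B hq h1 h2 h3 hB t' h5 h6)
    R t hR hRs hL hRt htL
  have hsq : (Real.sqrt A / (R : ℝ) ^ 4) ^ 2 = A / (R : ℝ) ^ 8 := by
    rw [div_pow, Real.sq_sqrt hA0, ← pow_mul]
  rw [hsq]
  exact hmain

/-- `E_T ⇒ D1` (restriction; same constants for every `κ`). [wuc certificate] -/
theorem pinnedTopOctave_of_tempered (hE : PinnedTemperedCeiling) : PinnedTopOctaveCeiling := by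
  intro G _ _ _ _ hG hcl
  letI : MeasurableSpace G := borel G
  haveI : BorelSpace G := ⟨rfl⟩
  intro r v f g h' Λ₅
  obtain ⟨ε₀, hε₀, hh⟩ := hE G hG hcl r v f g h' Λ₅
  refine ⟨ε₀, hε₀, fun ε hε hεε hfl => ?_⟩
  obtain ⟨M, C, ℓ₄, β₄, hℓ₄, hC, hmain⟩ := hh ε hε hεε hfl
  refine ⟨ℓ₄, hℓ₄, fun κ _ _ => ⟨M, C, β₄, hC, ?_⟩⟩
  intro β hβ s hs hs1 hsub hpin L q k R t hq hR hRs hL _hoct hRt htL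
  exact hmain β hβ s hs hs1 hsub hpin L q k R t hq hR hRs hL hRt htL

/-- `26791 ⇒ D2` with `K = 1`, `C₀ = C` (the full-strength ceiling makes the step free; pin ignored). [wuc certificate] -/
theorem pinnedOctaveStep_of_axisMirror (hA : AxisMirrorCeiling) : PinnedOctaveStep := by
  intro G _ _ _ _ hG hcl
  letI : MeasurableSpace G := borel G
  haveI : BorelSpace G := ⟨rfl⟩
  intro r v f g h' Λ₅
  obtain ⟨ε₀, hε₀, hh⟩ := hA G hG hcl r v f g h' Λ₅
  refine ⟨ε₀, hε₀, fun ε hε hεε hfl => ?_⟩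
  obtain ⟨C, ℓ₄, β₄, hℓ₄, hC, hmain⟩ := hh ε hε hεε hfl
  refine ⟨1, C, ℓ₄, β₄, hℓ₄, le_rfl, hC, ?_⟩
  intro β hβ s hs hs1 hsub _hpin L q k R B hq hR h2Rs h8 _hB t hRt htL
  have hRs : (R : ℝ) * s ≤ ℓ₄ := by nlinarith [show (0 : ℝ) ≤ (R : ℝ) * s by positivity]
  have := hmain β hβ s hs hs1 hsub L q k R t hq hR hRs (by omega) hRt htL
  rw [one_mul]
  exact this.trans (le_max_right _ _)

/-! ## §3 The stubs (7) -/

/-- ★ **N `stub_onsetFloorsK`** — the shared onset-floor residual in the compact-witness currency BY NAME (K1; = B4K of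
«MirrorCalibration» REV 5).  [N-wall; hard; residual-fed] -/
theorem stub_onsetFloorsK : OnsetFloorsK := by
  sorry

/-- ★ **D1 `stub_pinnedTopOctaveCeiling`** — hyperscaling ceiling on the NON-DOUBLABLE octave at the pinned onset scale only
(unit top octave(s) for every fixed `κ`, or torus top octave).  [E-wall n = 2 met ONE octave wide; hard; the wall, narrowed] -/
theorem stub_pinnedTopOctaveCeiling : PinnedTopOctaveCeiling := by
  sorry

/-- ★ **D2 `stub_pinnedOctaveStep`** — UV-ward octave regularity `|c| ≤ K·max(B_{2R}, (C₀/R⁴)²)` strictly below the pinned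
onset scale, ANY β-uniform `K`.  Intended proof class: inductive multiscale ∕ block-spin expansions with `O(1)` per-step
constants (Bałaban small-field effective actions; MRS), or a transfer-matrix Harnack inequality.  [L–XL; measurable octave by octave] -/
theorem stub_pinnedOctaveStep : PinnedOctaveStep := by
  sorry

/-- ★ **CAL `stub_temperedCalibrationK`** — tempered mirror calibration IN CEILING FORM, the twin of the LANDED B6K
`mirrorCalibrationK_proof` (§1–§7) with the slack carried: the joint onset unit `a(β)` of `jointOnsetUnit` (landed,
`…MirrorCalibrationOnset`) carries BOTH `∀L`-floors (`(hcal β hβ).1`) and the guard (`(hcal β hβ).2`) — it IS E_T's pinned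
test scale, so E_T is instantiated at `s := a β` (no re-test is possible or needed); the torus ceiling passes to the limit
states (`twoPoint_limitState`), general pairs are dominated by on-axis mirror pairs (RP Cauchy–Schwarz, the landed
`MirrorDomination.abs_cov_le_of_axisMirror`, same `R`, same slack), and the far-mirror square of an atom of scale
`s > K·aβ` is summed pair by pair as in `rpSquare_le_fine`/`rpSquare_le_coarse` (now for every axis ∕ plane ∕ offset, the
E1 geometry): its pairs sit at `R ≳ t_b/s` when `s < t_b` and at `R ≥ 1` with `s ≥ t_b` otherwise, so the slack
`(ℓ₄/(R aβ))^M ≤ (K ℓ₄/t_b)^M · (s/(K aβ))^M` in both regimes and is absorbed into the level `ε (s/a'β)^M`, `a' := K a`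
(floors transported by `lowerBoundsK_const_mul_iff`, `a' → 0` by `onsetVanishes_proof` as in B6K).  [provable-grade twin; L] -/
theorem stub_temperedCalibrationK :
    OnsetFloorsK → PinnedTemperedCeiling → TemperedAtomCeilingsK := by
  sorry

/-- ★ **W `stub_weightedWhitneyPkg`** — the weighted off-diagonal Whitney package (re-run of the landed
`WhitneyAssembly.whitneyPkg_of_gevrey` with flatness order `K + K₀ n` in `LevelMass.level_mass`); its weighted clause is
LOAD-BEARING for E3T below.  [pure analysis; L] -/
theorem stub_weightedWhitneyPkg : WhitneyPkgW := by
  sorry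

/-- ★ **E3T `stub_temperedMomentBoundA`** — the tempered all-order smeared bound: E3's proof (`smearedAtomicBound_proof` with the
landed `atomicSynthesis_proof'`), the E1-output it consumes now being the HYPOTHESIS at the piece-dependent level
`ε_j = ε (s_j/a)^M` (`s_j = a t_b/ρ_j` the synthesis scale of a piece of radius `ρ_j`), the loss `(t_b/ρ_j)^{Mn/2}` of
`(C n^θ √ε_j)ⁿ` (28168) absorbed by the weighted Whitney mass with `K₀ = ⌈M/2⌉`.  [provable-grade twin of E3; L/XL] -/
theorem stub_temperedMomentBoundA : WhitneyPkgW → AtomicSqrtDominationR → TemperedMomentBoundA := by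
  sorry

/-- ★ **K2R `stub_atomicSqrtDominationR`** — item 28168 `OnsetTautology.AtomicSqrtDominationR` BY NAME.  [E-wall n ≥ 3; by name] -/
theorem stub_atomicSqrtDominationR : AtomicSqrtDominationR := by
  sorry

/-! ## §4 The composition (sorry-free) -/

/-- **The composition** — concludes the leaf 19868 BY NAME from the seven stubs; the pinned tempered ceiling E_T is OBTAINED
from D1 and D2 by the proved dyadic reduction `pinnedTempered_of_octaves`. -/
theorem HypercubicOSDataFromInfiniteVolume_of_octaveDoubling :
    Summit.QuantumFields.YangMills.Theses.InfiniteVolumeContinuum.HypercubicOSDataFromInfiniteVolume :=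
  smearedIVDataK_proof
    (smearedIVInputK_of_temperedA
      (stub_temperedCalibrationK stub_onsetFloorsK
        (pinnedTempered_of_octaves stub_pinnedTopOctaveCeiling stub_pinnedOctaveStep))
      (stub_temperedMomentBoundA stub_weightedWhitneyPkg stub_atomicSqrtDominationR))

end Summit.QuantumFields.YangMills.Cruxes.HypercubicOSDataFromInfiniteVolume.OctaveDoubling

end
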